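import Literature.NumberTheory.EllipticCurves.ModularSymbolsMeasureApproximations
import Literature.NumberTheory.EllipticCurves.PAdicMeasureMomentsDetermine
import HarnessLib

/-!
# The injectivity half of Stevens' control theorem in slope `0` (measure-valued symbols)

For `p ∣ N` and the integral coefficient system `𝔻⁰_k` (`distCoeffInt`, weight-`k` action of `Σ₀(N)` on
`ℤ_p`-valued measures on `ℤ_p`) we prove the injectivity statement of Greenberg 2007, Thm. 9 /
Stevens' control theorem (Eigenbook Thm. 6.5.19) in the ordinary case:

**an `U_p`-eigensymbol `Φ ∈ Symb_{Γ₀(N)}(𝔻⁰_k)` with UNIT eigenvalue whose values have vanishing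
moments of order `≤ k` (i.e. whose specialisation to `Symᵏ` vanishes) is zero**
(`symb_eq_zero_of_hecke_eq_unit_smul`).

Proof (Greenberg, loc. cit., p. 151): the values lie in `F⁰ 𝔻⁰_k` (`mem_filG_zero_of_moments`); `U_p`
raises the filtration index by one (`hecke_val_mem_filGInt_succ`, from Lemma 11(2)
`weightActD_beta_mem_filG_succ` — for `p ∣ N` all Hecke representatives are `β_u = (1 u; 0 p)`), so
`Φ = u⁻¹ U_p Φ` has values in `⋂_N F^N = 0` (`eq_zero_of_forall_mem_filG`, Mahler).

Brick B2l-b of the bottom-up plan recorded with the named fact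
`greenbergStevens_kitagawa_twoVariable_interpolation_allBranches`.  Everything is proved; no named facts.

## References

* M. Greenberg, Israel J. Math. 161 (2007), Thm. 9 and its proof, p. 151. [Greenberg2007Lifting]
* J. Bellaïche, *The Eigenbook* (2021), Thm. 6.5.19. [folklore]
-/

noncomputable section

open scoped MatrixGroups
open Matrix CongruenceSubgroup

namespace Literature.NumberTheory.EllipticCurves

open ModularForms ModularForms.HidaCohomology

variable {p : ℕ} [Fact p.Prime]

/-! ### `F⁰` and the Hecke representatives for `p ∣ N` -/

/-- **`F⁰ 𝔻⁰_k` is the set of integral measures with vanishing moments of order `≤ k`** (the bound on the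
higher moments is automatic from integrality). [cite: Greenberg2007Lifting, §3] -/
theorem mem_filG_zero_of_moments {k : ℕ} {μ : (n : ℕ) → ZMod (p ^ n) → ℚ_[p]}
    (hμ : μ ∈ (ProfiniteTower.padicInt p).distributionsInt p) (h0 : ∀ i ≤ k, moment μ i = 0) : μ ∈ filG p k 0 := by
  refine ⟨hμ, h0, fun j hj => (norm_moment_le_one hμ _).trans ?_⟩
  have hp1 : (1 : ℝ) ≤ p := by exact_mod_cast (Fact.out : p.Prime).one_lt.le
  calc (1 : ℝ) = (p : ℝ) ^ (0 : ℤ) := (zpow_zero _).symm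
    _ ≤ (p : ℝ) ^ ((j : ℤ) - 1 - (0 : ℕ)) := zpow_le_zpow_right₀ hp1 (by push_cast; omega)

omit [Fact p.Prime] in
/-- For `p ∣ N` every Hecke index is finite: `i = some j`. [folklore] -/
theorem heckeIdx_eq_some {N : ℕ} (hpN : p ∣ N) (i : HeckeIdx N p) : ∃ j : ZMod p, i.1 = some j := by
  rcases h : i.1 with _ | j
  · exact absurd hpN (i.2 h)
  · exact ⟨j, rfl⟩

/-- The entries of `β_j = (1 j; 0 p)`. [folklore] -/
theorem heckeRep_some_entries (j : ZMod p) :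
    heckeRep p (some j) 0 0 = 1 ∧ heckeRep p (some j) 0 1 = (j.val : ℤ) ∧ heckeRep p (some j) 1 0 = 0 ∧
      heckeRep p (some j) 1 1 = (p : ℤ) := by
  simp [heckeRep]

/-- **The operator of `β_j` on `𝔻⁰_k` raises Greenberg's filtration**: `ρ(β_j)(F^n) ⊆ F^{n+1}`
(Lemma 11(2)). [cite: Greenberg2007Lifting, Lemma 11] -/
theorem distρInt_heckeRep_mem_filGInt_succ (k : ℕ) {N : ℕ} (hpN : p ∣ N) (j : ZMod p) (n : ℕ) (μ : DInt p)
    (hμ : μ ∈ filGInt p k n) : distρInt p k (heckeRep p (some j)) μ ∈ filGInt p k (n + 1) := by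
  have hmem : heckeRep p (some j) ∈ sigma0Set N :=
    heckeRep_mem_sigma0Set (N := N) Fact.out ⟨some j, fun h => (Option.some_ne_none j h).elim⟩
  have h := norm_entries_of_mem_sigma0Set (p := p) hpN hmem
  obtain ⟨e00, e01, e10, e11⟩ := heckeRep_some_entries (p := p) j
  rw [mem_filGInt_iff, distρInt_val_eq_weightActD k hpN hmem,
    weightActD_congr k h.1 h.2 norm_one norm_zero_lt_one' (b' := ((j.val : ℤ) : ℤ_[p])) (d' := (p : ℤ_[p]))
      (by rw [e00, Int.cast_one]) (by rw [e01]) (by rw [e10, Int.cast_zero]) (by rw [e11, Int.cast_natCast])]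
  exact weightActD_beta_mem_filG_succ k n _ (DInt.toDist μ) hμ

/-! ### `U_p` raises the filtration on symbols -/

/-- **If all values of `Φ` lie in `F^n` then all values of `U_p Φ` lie in `F^{n+1}`** (`p ∣ N`).
[cite: Greenberg2007Lifting, proof of Thm. 9] -/
theorem hecke_val_mem_filGInt_succ (k N : ℕ) (hpN : p ∣ N) [NeZero p] (n : ℕ)
    (Φ : P1Q → P1Q → DInt p) (hΦ : ∀ x y, Φ x y ∈ filGInt p k n) (x y : P1Q) :
    (distCoeffInt p k N hpN).hecke N p Φ x y ∈ filGInt p k (n + 1) := by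
  rw [CoeffActionOn.hecke_apply, Finset.sum_apply, Finset.sum_apply]
  refine Submodule.sum_mem _ fun i _ => ?_
  obtain ⟨j, hj⟩ := heckeIdx_eq_some hpN i
  rw [CoeffActionOn.slash_apply, distCoeffInt_ρ, hj]
  exact distρInt_heckeRep_mem_filGInt_succ k hpN j n _ (hΦ _ _)

/-! ### The theorem -/

/-- **Injectivity half of the slope-`0` control theorem** (Greenberg 2007, Thm. 9; Stevens): a
`U_p`-eigensymbol `Φ ∈ Symb_{Γ₀(N)}(𝔻⁰_k)` (`p ∣ N`) with unit eigenvalue `u` whose values have vanishing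
moments of order `≤ k` is zero. [cite: Greenberg2007Lifting, Thm. 9] -/
theorem symb_eq_zero_of_hecke_eq_unit_smul (k N : ℕ) (hpN : p ∣ N) [NeZero p]
    (Φ : (distCoeffInt p k N hpN).Symb (Gamma0 N)) (u : ℤ_[p]ˣ)
    (heigen : heckeInt k N hpN Φ = (u : ℤ_[p]) • Φ)
    (hmom : ∀ (x y : P1Q) (i : ℕ), i ≤ k → moment (Φ.1 x y).1 i = 0) : Φ = 0 := by
  -- all values lie in every `F^n`
  have hall : ∀ n : ℕ, ∀ x y, Φ.1 x y ∈ filGInt p k n := by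
    intro n
    induction n with
    | zero => exact fun x y => mem_filG_zero_of_moments (Φ.1 x y).2 (hmom x y)
    | succ n ih =>
      intro x y
      -- `Φ = u⁻¹ U_p Φ`
      have hval : Φ.1 x y = ((u⁻¹ : ℤ_[p]ˣ) : ℤ_[p]) • (distCoeffInt p k N hpN).hecke N p Φ.1 x y := by
        have h := congrArg (fun Ψ : (distCoeffInt p k N hpN).Symb (Gamma0 N) => (Ψ : P1Q → P1Q → DInt p) x y) heigen
        simp only [heckeInt, CoeffActionOn.coe_heckeSymb, Submodule.coe_smul, Pi.smul_apply] at h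
        rw [h, smul_smul, Units.inv_mul, one_smul]
      rw [hval]
      exact Submodule.smul_mem _ _ (hecke_val_mem_filGInt_succ k N hpN n Φ.1 ih x y)
  -- hence every value vanishes (Mahler)
  refine Subtype.ext (funext fun x => funext fun y => ?_)
  have hzero : DInt.toDist (Φ.1 x y) = 0 := eq_zero_of_forall_mem_filG (DInt.toDist (Φ.1 x y)) fun n => hall n x y
  have hval0 : (Φ.1 x y).1 = 0 := congrArg Subtype.val hzero
  exact Subtype.ext hval0

/-- The same statement with the eigenvalue as a unit-norm element of `ℤ_p`. [cite: Greenberg2007Lifting, Thm. 9] -/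
theorem symb_eq_zero_of_hecke_eq_smul_of_norm_eq_one (k N : ℕ) (hpN : p ∣ N) [NeZero p]
    (Φ : (distCoeffInt p k N hpN).Symb (Gamma0 N)) {a : ℤ_[p]} (ha : ‖a‖ = 1)
    (heigen : heckeInt k N hpN Φ = a • Φ)
    (hmom : ∀ (x y : P1Q) (i : ℕ), i ≤ k → moment (Φ.1 x y).1 i = 0) : Φ = 0 := by
  have hu : IsUnit a := PadicInt.isUnit_iff.mpr ha
  obtain ⟨u, rfl⟩ := hu
  exact symb_eq_zero_of_hecke_eq_unit_smul k N hpN Φ u heigen hmom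

end Literature.NumberTheory.EllipticCurves

end
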